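import Summits.HodgeConjecture.HodgeConjecture.Theorems.HCCMUnconditionalH21OfThm186
import Literature.NumberTheory.ComplexMultiplication.MainTheoremCMModelReduction
import Literature.NumberTheory.ComplexMultiplication.MainTheoremCMLevelGluingHolds
import Literature.NumberTheory.ComplexMultiplication.ShimuraTaniyamaOfMainTheoremInertia
import Literature.NumberTheory.DiophantineGeometry.AbelianSchemeModelInertiaOfGoodReduction
import HarnessLib

/-!
# `HCCMUnconditional.H21` from the LEVEL STRUCTURE of the main theorem of CM (S7a) — the h21 head over the fan-B line
# `b2_main_theorem_cm` (binder `h21`, [Shimura 1998, Thm. 21.4] ⇐ [Shimura 1998, Thm. 18.6])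

Topic: summit `HodgeConjecture`, sub-problem `HodgeConjecture`, route `HCCMUnconditional`, crux `H21` (item
stmt-HodgeConjecture-24834).  PROVER FILE (cell hodgecm-mathlib, D-0151 release track, ladder HODGECM-MATHLIB rung 0; seat A-p01,
the h21 closing-file holder; `--supports stmt-HodgeConjecture-24834`): sorry-free, axioms ⊆ trio, THEOREMS ONLY.

The A-line of `h21` is closed modulo row II-1 and the three reduction-theory records (A-p01 p606889 `H21_of_facts` /
`H21_of_thm18_6`, A-p10 p609133/p609423 `H21_of_thm18_6_of_records` with rows II-2/II-2β discharged by A-p14 p608173).  Row II-1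
`shimura1998_thm18_6` itself is the head of B-plan1's registered line `Cruxes/H21/Lines/b2_main_theorem_cm.lean` (v2m), whose
kernel-checked junction `shimura1998_thm18_6_of_levelStructure` (`MainTheoremCMLevelUniformization.lean`, B-typ03 p605528) reads
Thm. 18.6 off FOUR inputs: II-2 (✓ A-p14), S5b `exists_balancedDivisor_finiteExtension` (fact; A-p06's `FactS5b_of_S5b″` in
flight), S7a `levelStructure` (B-p15's harness `S7aHarness.core` / `levelStructure_of_facts`, in flight), S7b `levelGluing` (✓ B-p12
`levelGluing_holds`), through S7c `modelReduction` (✓ B-p06 `modelReduction_holds`).  This file composes them BY NAME so that the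
minute S7a lands the `h21` residual set is read off ONE theorem:

* `thm18_6_of_levelStructure (h7a : levelStructure) (h5b : exists_balancedDivisor_finiteExtension) : shimura1998_thm18_6`;
* `H21_of_levelStructure (h7a) (h5b) (h₁ h₂ h₃) : …HCCMUnconditional.H21` — **h21 ⇐ {S7a, S5b, VI-NOS ×3}**;
* `thm21_4_casselman_of_levelStructure` — the same on the binder's named `Prop` `shimura1998_thm21_4_casselman`;
* `casselmanCore_of_levelStructure (h7a) (h5b)` — the Frobenius-form Casselman core ⇐ {S7a, S5b} (no reduction record, no II-5).

The closing one-liner of the item, the day S7a's facts (`shimuraTaniyamaPair`, `FactRH′`, `FactS5c`), S5b and the three records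
have `_holds`: `H21_proof := H21_of_levelStructure (levelStructure_of_facts …) ‹S5b› ‹NOS₁› ‹NOS₂› ‹NOS₃›`.  HC_CM is proved only
modulo the 7 printed citations until rung 0 closes; this file discharges no binder by itself.

## References
* [Shimura1998] G. Shimura, *Abelian Varieties with Complex Multiplication and Modular Functions*, Princeton Univ. Press (1998):
  §18.6 Thm. 18.6 and its proof (pp. 164–169); §21.4 Thm. 21.4 (p. 192); §12.4 Prop. 26; §6.2 Thm. 4 (3); Thm. 19.11.
* [SerreTate1968] J.-P. Serre, J. Tate, *Good reduction of abelian varieties*, Ann. of Math. 88 (1968), §7 Thm. 10–12; §1 Thm. 1.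
-/

set_option autoImplicit false

open IsDedekindDomain
open NumberField hiding ideleGroup
open scoped NumberField

namespace Summit.HodgeConjecture.CorCM.Hyp21

open Literature.AlgebraicGeometry.Motives
open Literature.NumberTheory.GaloisRepresentations
open Literature.NumberTheory.ComplexMultiplication
open CategoryTheory
open scoped ComplexConjugate nonZeroDivisors

/-- **Row II-1 (the Main Theorem of CM, [Shimura1998, Thm. 18.6]) from the level structure S7a and the balanced-divisor fact S5b**,
everything else BY NAME: the junction `shimura1998_thm18_6_of_levelStructure` (B-typ03) fed with S7c `modelReduction_holds` (B-p06),
II-2 `shimura1998_prop26_definedOverNumberField_holds` (A-p14), S7b `levelGluing_holds` (B-p12).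
[cite: Shimura1998, §18.6 Thm. 18.6, proof pp. 164–169] -/
theorem thm18_6_of_levelStructure (h7a : levelStructure) (h5b : exists_balancedDivisor_finiteExtension) :
    shimura1998_thm18_6 :=
  shimura1998_thm18_6_of_levelStructure modelReduction_holds shimura1998_prop26_definedOverNumberField_holds h5b h7a
    levelGluing_holds

/-- **`HCCMUnconditional.H21` ⇐ {S7a `levelStructure`, S5b `exists_balancedDivisor_finiteExtension`, the three reduction-theory records}.**
A-p10's `H21_of_thm18_6_of_records` (over A-p01's `H21_of_thm18_6`, rows II-2/II-2β discharged) at `h186 := thm18_6_of_levelStructure h7a h5b`;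
the records `h₁ h₂ h₃` (Néron model datum `nonempty_goodReductionAt`, `ℓ`-adic specialisation datum `nonempty_tateSpecialisation`, converse
Néron–Ogg–Šafarevič `hasGoodReductionAt_of_isUnramifiedAt`) are the binders of `H21_of_thm18_6` verbatim.  HC_CM is proved only modulo the
7 printed citations until rung 0 closes. [cite: Shimura1998, §21.4 Thm. 21.4; §18.6 Thm. 18.6; Thm. 19.11] [cite: SerreTate1968, §7 Thm. 10–12; §1 Thm. 1] -/
theorem H21_of_levelStructure (h7a : levelStructure) (h5b : exists_balancedDivisor_finiteExtension)
    (h₁ : ∀ (k : Type) [Field k] [NumberField k] (A₀ : AbelianVariety k) (v : HeightOneSpectrum (𝓞 k)),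
      AbelianVariety.nonempty_goodReductionAt A₀ v)
    (h₂ : ∀ (k : Type) [Field k] [NumberField k] (A₀ : AbelianVariety k) (v : HeightOneSpectrum (𝓞 k))
      (R : A₀.GoodReductionAt v) (ℓ : ℕ) [Fact ℓ.Prime], R.nonempty_tateSpecialisation ℓ)
    (h₃ : ∀ (k : Type) [Field k] [NumberField k] (A₀ : AbelianVariety k) (v : HeightOneSpectrum (𝓞 k)),
      AbelianVariety.hasGoodReductionAt_of_isUnramifiedAt A₀ v) :
    Summit.HodgeConjecture.HodgeConjecture.Theses.HCCMUnconditional.H21 :=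
  H21_of_thm18_6_of_records (thm18_6_of_levelStructure h7a h5b) h₁ h₂ h₃

/-- **[Shimura1998, Thm. 21.4] in the binder's named-`Prop` form `shimura1998_thm21_4_casselman` ⇐ {S7a, S5b, the three records}**
(`H21 = shimura1998_thm21_4_casselman` by `rfl`; A-p10's `thm21_4_casselman_of_thm18_6_of_records` at `thm18_6_of_levelStructure`).
[cite: Shimura1998, §21.4 Thm. 21.4; §18.6 Thm. 18.6; Thm. 19.11] [cite: SerreTate1968, §7 Thm. 10–12; §1 Thm. 1] -/
theorem thm21_4_casselman_of_levelStructure (h7a : levelStructure) (h5b : exists_balancedDivisor_finiteExtension)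
    (h₁ : ∀ (k : Type) [Field k] [NumberField k] (A₀ : AbelianVariety k) (v : HeightOneSpectrum (𝓞 k)),
      AbelianVariety.nonempty_goodReductionAt A₀ v)
    (h₂ : ∀ (k : Type) [Field k] [NumberField k] (A₀ : AbelianVariety k) (v : HeightOneSpectrum (𝓞 k))
      (R : A₀.GoodReductionAt v) (ℓ : ℕ) [Fact ℓ.Prime], R.nonempty_tateSpecialisation ℓ)
    (h₃ : ∀ (k : Type) [Field k] [NumberField k] (A₀ : AbelianVariety k) (v : HeightOneSpectrum (𝓞 k)),
      AbelianVariety.hasGoodReductionAt_of_isUnramifiedAt A₀ v) :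
    shimura1998_thm21_4_casselman :=
  thm21_4_casselman_of_thm18_6_of_records (thm18_6_of_levelStructure h7a h5b) h₁ h₂ h₃

/-- **The Frobenius-form Casselman core ⇐ {S7a, S5b} alone** (no reduction-theory record, no II-5): A-p10's `casselmanCore_of_thm18_6`
(over A-p01's `casselmanCore_of_facts`, II-2 discharged) at `thm18_6_of_levelStructure`. [cite: Shimura1998, §21.4 Thm. 21.4 (proof, p. 192); §18.6 Thm. 18.6] -/
theorem casselmanCore_of_levelStructure (h7a : levelStructure) (h5b : exists_balancedDivisor_finiteExtension) :
    ∀ (k : Type) [Field k] [NumberField k] [Algebra k ℂ] (K : Type) [Field K] [NumberField K]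
      [IsCMField K] (Φ : CMType K) (τ₀ : K →+* ℂ) (χ : HeckeCharacter k),
    ((traceField Φ : Set ℂ) ⊆ Set.range (algebraMap k ℂ)) →
    χ.HasInfinityType (cmInfinityType Φ.1 τ₀ (algebraMap k ℂ)).1
      (cmInfinityType Φ.1 τ₀ (algebraMap k ℂ)).2 →
    (∀ x : ideleGroup k, (x : AdeleRing (𝓞 k) k).1 = 1 →
      (∃ b : K, ((χ x : ℂˣ) : ℂ) = τ₀ b) ∧
        ((χ x : ℂˣ) : ℂ) * conj ((χ x : ℂˣ) : ℂ) = (((ideleNorm x)⁻¹ : ℝ) : ℂ)) →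
    (∀ (v : HeightOneSpectrum (𝓞 k)) (u : (v.adicCompletionIntegers k)ˣ),
      ∃ b : (𝓞 K)ˣ, ((χ.localComponent v
        (Units.map ((v.adicCompletionIntegers k).subtype : _ →* _) u) : ℂˣ) : ℂ) =
        τ₀ ((b : 𝓞 K) : K)) →
    (∀ v : HeightOneSpectrum (𝓞 k), ∃ π : 𝓞 K, χ.valueAtUniformizer v = τ₀ (π : K) ∧
      ∀ (L : Type) [Field L] [NumberField L] [Normal ℚ L] (ιL : L →+* ℂ) (j : K →+* L)
        (σL : k →+* L), ιL.comp σL = algebraMap k ℂ →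
        IsReflexTypeNorm (valuedIn ιL Φ.1) j σL v.asIdeal (Ideal.span {π})) →
    ∃ (A₀ : AbelianVariety k) (ι₀ : 𝓞 K →+* End A₀),
      IsCMTypeRealisationOver Φ A₀ ι₀ ∧
      ∀ v : HeightOneSpectrum (𝓞 k), χ.IsUnramifiedAt v →
        ∃ π : 𝓞 K, χ.valueAtUniformizer v = τ₀ (π : K) ∧
          ∀ (ℓ : ℕ) [Fact ℓ.Prime], (ℓ : 𝓞 k) ∉ v.asIdeal →
            ∀ 𝔓 ∈ v.primesAbove, ∀ σ : Field.absoluteGaloisGroup k, IsArithFrobAt (𝓞 k) σ 𝔓 →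
              A₀.tateRep ℓ σ = AbelianVariety.tateModuleMap ℓ (ι₀ π : A₀ ⟶ A₀) :=
  casselmanCore_of_thm18_6 (thm18_6_of_levelStructure h7a h5b)

/-! ## Appendix (consumer-side VI-NOS edition, director BATCH 68/71 «GO-lite»): the INERTIA hypothesis in place of the two
record facts `nonempty_goodReductionAt` / `nonempty_tateSpecialisation` -/

/-- **`HCCMUnconditional.H21` ⇐ {row II-1 `shimura1998_thm18_6`, «good reduction ⇒ `T_ℓ` unramified» (inertia form), converse
Néron–Ogg–Šafarevič}.**  A-p01's `H21_of_facts` with rows II-2 discharged (A-p14) and row II-5 read from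
`shimuraTaniyama_heckeCharacters_of_thm18_6_of_inertia` (`ShimuraTaniyamaOfMainTheoremInertia.lean`): the consumer trace of the cell shows
that the `h21` cone uses the two reduction DATA facts only through «at a place of good reduction, for every prime `ℓ ∤ v`, some prime
`𝔓 ∣ v` of `ℤ̄_k` has inertia acting trivially on `T_ℓ A₀`» ([SerreTate1968] §1 Thm. 1, easy direction; [Shimura1998] Lemma 19.5),
which is the binder `h₁₂` here; `h₃` is the converse direction as before.  Today's facts give `h₁₂`
(`forall_inertia_tateRep_eq_one_of_nonempty_goodReductionAt`); the abelian-scheme-model road (finite-étale `ℓⁿ`-torsion of a Néron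
model) will give it as a theorem.  HC_CM is proved only modulo the 7 printed citations until rung 0 closes.
[cite: Shimura1998, §21.4 Thm. 21.4; §18.6 Thm. 18.6; Thm. 19.11; Lemma 19.5] [cite: SerreTate1968, §7 Thm. 10–12; §1 Thm. 1] -/
theorem H21_of_thm18_6_of_inertia (h186 : shimura1998_thm18_6)
    (h₁₂ : ∀ (k : Type) [Field k] [NumberField k] (A₀ : AbelianVariety k) (v : HeightOneSpectrum (𝓞 k)),
      HasGoodReductionAt A₀.X A₀.dim v → ∀ (ℓ : ℕ) [Fact ℓ.Prime], (ℓ : 𝓞 k) ∉ v.asIdeal →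
        ∃ 𝔓 ∈ v.primesAbove, ∀ σ ∈ 𝔓.inertia (Field.absoluteGaloisGroup k), A₀.tateRep ℓ σ = 1)
    (h₃ : ∀ (k : Type) [Field k] [NumberField k] (A₀ : AbelianVariety k) (v : HeightOneSpectrum (𝓞 k)),
      AbelianVariety.hasGoodReductionAt_of_isUnramifiedAt A₀ v) :
    Summit.HodgeConjecture.HodgeConjecture.Theses.HCCMUnconditional.H21 :=
  H21_of_facts h186 shimura1998_prop26_definedOverNumberField_holds
    (shimuraTaniyama_heckeCharacters_of_thm18_6_of_inertia h186 h₁₂ h₃)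

/-- **`HCCMUnconditional.H21` ⇐ {S7a `levelStructure`, S5b, the inertia hypothesis, converse Néron–Ogg–Šafarevič}** — the
level-structure head of this file in the inertia edition (`thm18_6_of_levelStructure` then `H21_of_thm18_6_of_inertia`).  HC_CM is proved
only modulo the 7 printed citations until rung 0 closes. [cite: Shimura1998, §21.4 Thm. 21.4; §18.6 Thm. 18.6; Thm. 19.11; Lemma 19.5]
[cite: SerreTate1968, §7 Thm. 10–12; §1 Thm. 1] -/
theorem H21_of_levelStructure_of_inertia (h7a : levelStructure) (h5b : exists_balancedDivisor_finiteExtension)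
    (h₁₂ : ∀ (k : Type) [Field k] [NumberField k] (A₀ : AbelianVariety k) (v : HeightOneSpectrum (𝓞 k)),
      HasGoodReductionAt A₀.X A₀.dim v → ∀ (ℓ : ℕ) [Fact ℓ.Prime], (ℓ : 𝓞 k) ∉ v.asIdeal →
        ∃ 𝔓 ∈ v.primesAbove, ∀ σ ∈ 𝔓.inertia (Field.absoluteGaloisGroup k), A₀.tateRep ℓ σ = 1)
    (h₃ : ∀ (k : Type) [Field k] [NumberField k] (A₀ : AbelianVariety k) (v : HeightOneSpectrum (𝓞 k)),
      AbelianVariety.hasGoodReductionAt_of_isUnramifiedAt A₀ v) :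
    Summit.HodgeConjecture.HodgeConjecture.Theses.HCCMUnconditional.H21 :=
  H21_of_thm18_6_of_inertia (thm18_6_of_levelStructure h7a h5b) h₁₂ h₃

/-- **The records head is an instance of the inertia head** (sanity bridge: the three record facts of `H21_of_levelStructure` imply
the inertia hypothesis, `forall_inertia_tateRep_eq_one_of_nonempty_goodReductionAt`), so the inertia edition is never weaker than
the edition of record.  HC_CM is proved only modulo the 7 printed citations until rung 0 closes.
[cite: Shimura1998, Lemma 19.5] [cite: SerreTate1968, §1 Thm. 1] -/
theorem H21_of_levelStructure_of_records_via_inertia (h7a : levelStructure) (h5b : exists_balancedDivisor_finiteExtension)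
    (h₁ : ∀ (k : Type) [Field k] [NumberField k] (A₀ : AbelianVariety k) (v : HeightOneSpectrum (𝓞 k)),
      AbelianVariety.nonempty_goodReductionAt A₀ v)
    (h₂ : ∀ (k : Type) [Field k] [NumberField k] (A₀ : AbelianVariety k) (v : HeightOneSpectrum (𝓞 k))
      (R : A₀.GoodReductionAt v) (ℓ : ℕ) [Fact ℓ.Prime], R.nonempty_tateSpecialisation ℓ)
    (h₃ : ∀ (k : Type) [Field k] [NumberField k] (A₀ : AbelianVariety k) (v : HeightOneSpectrum (𝓞 k)),
      AbelianVariety.hasGoodReductionAt_of_isUnramifiedAt A₀ v) :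
    Summit.HodgeConjecture.HodgeConjecture.Theses.HCCMUnconditional.H21 :=
  H21_of_levelStructure_of_inertia h7a h5b
    (fun k _ _ A₀ v hgood ℓ _ hℓ =>
      forall_inertia_tateRep_eq_one_of_nonempty_goodReductionAt (h₁ k A₀ v) (fun R ℓ _ => h₂ k A₀ v R ℓ) hgood ℓ hℓ)
    h₃

/-! ## Appendix 2 (director g3 BATCH 77–81, J-h12 = (b)): the bridge r₀ in place of `h₁₂` -/

/-- **`HCCMUnconditional.H21` ⇐ {row II-1, r₀ «a smooth proper model of an abelian variety is an abelian scheme», converse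
Néron–Ogg–Šafarevič}.**  `H21_of_thm18_6_of_inertia` with its inertia hypothesis `h₁₂` DISCHARGED modulo the bare algebraic-geometry
bridge r₀ — the body of the cell's named fact `exists_isAbelianSchemeModel_of_hasGoodReductionAt` (B-typ01; [BLRNeronModels1990]
1.2/8, 4.4/1), spelled as a binder — through `forall_inertia_tateRep_eq_one_of_hasGoodReductionAt` (Serre–Tate §1 Thm. 1 easy
direction in produced currency: B-p07's Lemma 2 `…injOn_geomTorsion_pow` + B-p09's inertia corollary).  HC_CM is proved only modulo
the 7 printed citations until rung 0 closes. [cite: Shimura1998, §21.4 Thm. 21.4; §18.6 Thm. 18.6; Thm. 19.11]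
[cite: SerreTate1968, §1 Thm. 1 and Lemma 2; §7 Thm. 10–12] [cite: BLRNeronModels1990, §1.2 Prop. 8 and §4.4 Thm. 1] -/
theorem H21_of_thm18_6_of_r₀ (h186 : shimura1998_thm18_6)
    (hr₀ : ∀ {K : Type} [Field K] [NumberField K] (A : AbelianVariety K) (v : HeightOneSpectrum (𝓞 K)),
      HasGoodReductionAt A.X A.dim v →
        ∃ (𝒜 : SchemeOver (HeightOneSpectrum.valuationSubringAtPrime K v)) (_ : GrpObj 𝒜),
          Literature.NumberTheory.DiophantineGeometry.IsAbelianSchemeModel A v 𝒜)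
    (h₃ : ∀ (k : Type) [Field k] [NumberField k] (A₀ : AbelianVariety k) (v : HeightOneSpectrum (𝓞 k)),
      AbelianVariety.hasGoodReductionAt_of_isUnramifiedAt A₀ v) :
    Summit.HodgeConjecture.HodgeConjecture.Theses.HCCMUnconditional.H21 :=
  H21_of_thm18_6_of_inertia h186
    (fun _ _ _ A₀ v hgood ℓ _ hℓ =>
      Literature.NumberTheory.DiophantineGeometry.forall_inertia_tateRep_eq_one_of_hasGoodReductionAt hr₀ A₀ v hgood ℓ hℓ)
    h₃

/-- **`HCCMUnconditional.H21` ⇐ {S7a `levelStructure`, S5b, r₀, converse Néron–Ogg–Šafarevič}** — the level-structure head in the r₀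
edition (`thm18_6_of_levelStructure` then `H21_of_thm18_6_of_r₀`); this is the `h21` leaf form of the cell's floor after the R-package
(h₁, h₂ ↦ h₁₂ ↦ r₀).  HC_CM is proved only modulo the 7 printed citations until rung 0 closes.
[cite: Shimura1998, §21.4 Thm. 21.4; §18.6 Thm. 18.6; Thm. 19.11] [cite: SerreTate1968, §1 Thm. 1; §7 Thm. 10–12]
[cite: BLRNeronModels1990, §1.2 Prop. 8 and §4.4 Thm. 1] -/
theorem H21_of_levelStructure_of_r₀ (h7a : levelStructure) (h5b : exists_balancedDivisor_finiteExtension)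
    (hr₀ : ∀ {K : Type} [Field K] [NumberField K] (A : AbelianVariety K) (v : HeightOneSpectrum (𝓞 K)),
      HasGoodReductionAt A.X A.dim v →
        ∃ (𝒜 : SchemeOver (HeightOneSpectrum.valuationSubringAtPrime K v)) (_ : GrpObj 𝒜),
          Literature.NumberTheory.DiophantineGeometry.IsAbelianSchemeModel A v 𝒜)
    (h₃ : ∀ (k : Type) [Field k] [NumberField k] (A₀ : AbelianVariety k) (v : HeightOneSpectrum (𝓞 k)),
      AbelianVariety.hasGoodReductionAt_of_isUnramifiedAt A₀ v) :
    Summit.HodgeConjecture.HodgeConjecture.Theses.HCCMUnconditional.H21 :=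
  H21_of_thm18_6_of_r₀ (thm18_6_of_levelStructure h7a h5b) hr₀ h₃

end Summit.HodgeConjecture.CorCM.Hyp21
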